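import Summits.AtomisticToContinuum.Crystallization.Theses.PricedLinkCensus
import Summits.AtomisticToContinuum.Crystallization.Theorems.TruncatedCensusGap.Negative.KappaZeroHalf
import Summits.AtomisticToContinuum.Crystallization.Theorems.PricedLinkCensusTruncatedCensusGapPeriodicStability
import Summits.AtomisticToContinuum.Crystallization.Theorems.PricedLinkCensusTruncatedCensusGapSuperstableRedistribution
import Summits.AtomisticToContinuum.Crystallization.Theorems.PricedLinkCensusTruncatedCensusGapCompactnessExtraction
import Summits.AtomisticToContinuum.Crystallization.Theorems.PricedLinkCensusTruncatedCensusGapChargeFreeOpenAtBarlow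
import Summits.AtomisticToContinuum.Crystallization.Theorems.PricedLinkCensusTruncatedCensusGapSeparatedReduction

/-!
# `TruncatedCensusGap` reduces to a sharp m-potential on uniformly separated configurations

Helper file for the crux `PricedLinkCensus.TruncatedCensusGap` (item stmt-AtomisticToContinuum-14230),
line `sharp-m-potential-compactness`, reshape r3 of its skeleton
(`Cruxes/TruncatedCensusGap/Lines/sharp_m_potential_compactness.lean`).  It records in importable form
what the five landed stubs of the line buy (p124427 superstability redistribution, p126512 separated
reduction, p124882 compactness extraction, p125113 open margin, p84999 periodic stability): the crux
follows from the ONE remaining registered stub `stub_sharpLocalisationSeparated` —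

* `truncatedCensusGap_of_sharpLocalisationSeparated` — a SHARP m-POTENTIAL ON UNIFORMLY `1/4`-SEPARATED
  finite injective configurations (radius `R ≥ 9/4`, energy `e₀`, site functional `H` with domination
  `Σ H ≤ E_χ − N e₀`, `H ≥ 0`, patch-locality at `R − 1/4`, matching-continuity at `R`, zero set
  `H = 0 ⇒` near-Barlow(δ, 4a) for every `δ > 0` at a scale with `9a/2 ≤ R`, and finite clusters with
  `E_χ ≤ N (e₀ + ε)`) implies `TruncatedCensusGap`.

The hypothesis is spelled out over tree declarations (it is the registered signature of the stub), so a
later file proving it closes the crux in three lines.  Logic (the line's composition): the separated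
reduction and the redistribution at radius `9/4` give the m-potential `H'` on all configurations
(`r₀ = 1/4`, floor `M₀`); compactness extraction at the open-margin tolerance makes `H' ≥ κ` at every
charged crowd-free tame site; crowded sites carry `H' ≥ M₀`; charged crowd-free non-tame sites have a
crowded site within `R` and at most `(2R/r₀+1)³` crowd-free sites surround any point, so
`Σ H' ≥ κ' · #charged` with `κ' = min κ (M₀/(K+1))`; finally `N e_χ* ≤ N e₀` by periodic stability, the
cluster clause and the landed `iInf_energyPerParticle_le_div`.
-/

noncomputable section

namespace Summit.AtomisticToContinuum.Crystallization.Theorems.PricedLinkCensusTruncatedCensusGap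

open scoped BigOperators Classical
open Literature.MathematicalPhysics.StatisticalMechanics Literature.Geometry.DiscreteGeometry

/-- A non-tame patch (some two sites of the closed `R`-ball about `y i` closer than `r₀`) contains
a site with a partner closer than `r₀` within `R` of its root. -/
private theorem exists_crowded_near_of_not_tame {N : ℕ} {y : Fin N → EuclideanSpace ℝ (Fin 3)} {R r₀ : ℝ} {i : Fin N}
    (h : ¬ ∀ j k : Fin N, j ≠ k → dist (y j) (y i) ≤ R → dist (y k) (y i) ≤ R → r₀ ≤ dist (y j) (y k)) :
    ∃ j : Fin N, ¬ (∀ k : Fin N, k ≠ j → r₀ ≤ dist (y k) (y j)) ∧ dist (y i) (y j) ≤ R := by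
  push Not at h
  obtain ⟨j, k, hjk, hj, -, hlt⟩ := h
  refine ⟨j, fun hiso => ?_, by rwa [dist_comm]⟩
  have := hiso k hjk.symm
  rw [dist_comm] at this
  linarith

/-- PACKING: at most `(2R/r₀ + 1)³` crowd-free sites (scale `r₀ > 0`: all other sites at distance
`≥ r₀`) lie within `R` of any site (tree lemma `card_le_of_separated_of_dist_le`). -/
private theorem card_crowdFree_near_le' {N : ℕ} {y : Fin N → EuclideanSpace ℝ (Fin 3)} (hy : Function.Injective y)
    {r₀ R : ℝ} (hr₀ : 0 < r₀) (hR : 0 ≤ R) (j : Fin N) :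
    ((Finset.univ.filter fun i : Fin N =>
        (∀ k : Fin N, k ≠ i → r₀ ≤ dist (y k) (y i)) ∧ dist (y i) (y j) ≤ R).card : ℝ) ≤
      (2 * R / r₀ + 1) ^ Module.finrank ℝ (EuclideanSpace ℝ (Fin 3)) := by
  set S := Finset.univ.filter fun i : Fin N =>
    (∀ k : Fin N, k ≠ i → r₀ ≤ dist (y k) (y i)) ∧ dist (y i) (y j) ≤ R with hS
  have hcard : (S.image y).card = S.card := Finset.card_image_of_injective _ hy
  have h := card_le_of_separated_of_dist_le (S.image y) (y j) hr₀ hR ?_ ?_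
  · rw [hcard] at h
    exact h
  · intro c hc
    obtain ⟨i, hi, rfl⟩ := Finset.mem_image.1 hc
    exact (Finset.mem_filter.1 hi).2.2
  · intro c hc d hd hcd
    obtain ⟨i, hi, rfl⟩ := Finset.mem_image.1 hc
    obtain ⟨i', hi', rfl⟩ := Finset.mem_image.1 hd
    have hne : i ≠ i' := fun h => hcd (h ▸ rfl)
    exact (Finset.mem_filter.1 hi').2.1 i hne

/-- DOUBLE COUNTING: a set of crowd-free sites each having a crowded site within `R` has at most
`(2R/r₀ + 1)³` times as many elements as there are crowded sites. -/
private theorem card_le_mul_card_crowded' {N : ℕ} {y : Fin N → EuclideanSpace ℝ (Fin 3)} (hy : Function.Injective y)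
    {r₀ R : ℝ} (hr₀ : 0 < r₀) (hR : 0 ≤ R) (P : Finset (Fin N))
    (hP : ∀ i ∈ P, (∀ k : Fin N, k ≠ i → r₀ ≤ dist (y k) (y i)) ∧
      ∃ j : Fin N, ¬ (∀ k : Fin N, k ≠ j → r₀ ≤ dist (y k) (y j)) ∧ dist (y i) (y j) ≤ R) :
    (P.card : ℝ) ≤ (2 * R / r₀ + 1) ^ Module.finrank ℝ (EuclideanSpace ℝ (Fin 3)) *
      ((Finset.univ.filter fun j : Fin N => ¬ ∀ k : Fin N, k ≠ j → r₀ ≤ dist (y k) (y j)).card : ℝ) := by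
  set K : ℝ := (2 * R / r₀ + 1) ^ Module.finrank ℝ (EuclideanSpace ℝ (Fin 3)) with hK
  have hK0 : 0 ≤ K := by positivity
  let w : Fin N → Fin N := fun i =>
    if h : ∃ j : Fin N, ¬ (∀ k : Fin N, k ≠ j → r₀ ≤ dist (y k) (y j)) ∧ dist (y i) (y j) ≤ R then
      Classical.choose h else i
  have hw : ∀ i ∈ P, ¬ (∀ k : Fin N, k ≠ w i → r₀ ≤ dist (y k) (y (w i))) ∧
      dist (y i) (y (w i)) ≤ R := by
    intro i hi
    obtain ⟨-, hex⟩ := hP i hi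
    simp only [w, dif_pos hex]
    exact Classical.choose_spec hex
  have himg : P.image w ⊆ Finset.univ.filter fun j : Fin N =>
      ¬ ∀ k : Fin N, k ≠ j → r₀ ≤ dist (y k) (y j) := by
    intro j hj
    obtain ⟨i, hi, rfl⟩ := Finset.mem_image.1 hj
    exact Finset.mem_filter.2 ⟨Finset.mem_univ _, (hw i hi).1⟩
  have hfib : ∀ j ∈ P.image w, ((P.filter fun i => w i = j).card : ℝ) ≤ K := by
    intro j _
    have hsub : (P.filter fun i => w i = j) ⊆ Finset.univ.filter fun i : Fin N =>
        (∀ k : Fin N, k ≠ i → r₀ ≤ dist (y k) (y i)) ∧ dist (y i) (y j) ≤ R := by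
      intro i hi
      obtain ⟨hiP, hwi⟩ := Finset.mem_filter.1 hi
      refine Finset.mem_filter.2 ⟨Finset.mem_univ _, (hP i hiP).1, ?_⟩
      have := (hw i hiP).2
      rwa [hwi] at this
    calc ((P.filter fun i => w i = j).card : ℝ)
        ≤ ((Finset.univ.filter fun i : Fin N =>
            (∀ k : Fin N, k ≠ i → r₀ ≤ dist (y k) (y i)) ∧ dist (y i) (y j) ≤ R).card : ℝ) := by
          exact_mod_cast Finset.card_le_card hsub
      _ ≤ K := card_crowdFree_near_le' hy hr₀ hR j
  have hsum : P.card = ∑ j ∈ P.image w, (P.filter fun i => w i = j).card :=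
    Finset.card_eq_sum_card_image w P
  calc (P.card : ℝ) = ∑ j ∈ P.image w, ((P.filter fun i => w i = j).card : ℝ) := by
        rw [hsum]
        push_cast
        rfl
    _ ≤ ∑ j ∈ P.image w, K := Finset.sum_le_sum hfib
    _ = K * (P.image w).card := by rw [Finset.sum_const, nsmul_eq_mul, mul_comm]
    _ ≤ K * ((Finset.univ.filter fun j : Fin N =>
          ¬ ∀ k : Fin N, k ≠ j → r₀ ≤ dist (y k) (y j)).card : ℝ) := by
        have himg' : ((P.image w).card : ℝ) ≤ ((Finset.univ.filter fun j : Fin N =>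
            ¬ ∀ k : Fin N, k ≠ j → r₀ ≤ dist (y k) (y j)).card : ℝ) := by
          exact_mod_cast Finset.card_le_card himg
        exact mul_le_mul_of_nonneg_left himg' hK0

/-- The landed superstability redistribution (p124427) AT ITS RADIUS `9/4`, re-assembled from the
landed file's public lemmas (the cloud-form transfer `F`). -/
private theorem superstableRedistribution94' :
    ∃ F : (N : ℕ) → (Fin N → EuclideanSpace ℝ (Fin 3)) → Fin N → ℝ,
      (∀ (N N' : ℕ) (y : Fin N → EuclideanSpace ℝ (Fin 3)) (y' : Fin N' → EuclideanSpace ℝ (Fin 3))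
          (i : Fin N) (i' : Fin N')
          (g : EuclideanSpace ℝ (Fin 3) ≃ᵃⁱ[ℝ] EuclideanSpace ℝ (Fin 3)),
        Function.Injective y → Function.Injective y' → g (y i) = y' i' →
        (∀ j : Fin N, dist (y j) (y i) ≤ 9 / 4 → g (y j) ∈ Set.range y') →
        (∀ j' : Fin N', dist (y' j') (y' i') ≤ 9 / 4 → y' j' ∈ g '' Set.range y) →
        F N y i = F N' y' i') ∧
      (∀ (N : ℕ) (y : Fin N → EuclideanSpace ℝ (Fin 3)), Function.Injective y → ∑ i, F N y i = 0) ∧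
      (∀ (N : ℕ) (y : Fin N → EuclideanSpace ℝ (Fin 3)) (i : Fin N), Function.Injective y →
        (∀ j k : Fin N, j ≠ k → dist (y j) (y i) ≤ 9 / 4 → dist (y k) (y i) ≤ 9 / 4 →
          1 / 4 ≤ dist (y j) (y k)) →
        F N y i = 0) ∧
      (∀ (N M : ℕ) (y : Fin N → EuclideanSpace ℝ (Fin 3)) (f : Fin M ↪ Fin N) (i : Fin M),
        Function.Injective y →
        (∀ k : Fin N, k ∈ Set.range f ↔ ∀ k' : Fin N, k' ≠ k → 1 / 4 ≤ dist (y k') (y k)) →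
        siteEnergy (fun r => min 1 (max 0 (4 - 2 * r)) * lennardJones r) (y ∘ f) i / 2 ≤
          siteEnergy (fun r => min 1 (max 0 (4 - 2 * r)) * lennardJones r) y (f i) / 2
            + F N y (f i)) ∧
      (∀ (N : ℕ) (y : Fin N → EuclideanSpace ℝ (Fin 3)) (i : Fin N), Function.Injective y →
        ¬ (∀ k : Fin N, k ≠ i → 1 / 4 ≤ dist (y k) (y i)) →
        1 ≤ siteEnergy (fun r => min 1 (max 0 (4 - 2 * r)) * lennardJones r) y i / 2 + F N y i) := by
  obtain ⟨t, ht⟩ : ∃ t : ℝ → ℕ → ℕ → ℝ, ∀ v a b, t v a b =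
      if v < 0 then (if a < b then -v / 2 else if b < a then v / 2 else 0) else 0 :=
    ⟨fun v a b => if v < 0 then (if a < b then -v / 2 else if b < a then v / 2 else 0) else 0,
      fun _ _ _ => rfl⟩
  obtain ⟨F, hF⟩ : ∃ F : (N : ℕ) → (Fin N → EuclideanSpace ℝ (Fin 3)) → Fin N → ℝ,
      ∀ N y i, F N y i = ∑ p ∈ (Finset.univ.filter fun k => dist (y k) (y i) ≤ 9 / 4).image y,
        t (min 1 (max 0 (4 - 2 * dist (y i) p)) * lennardJones (dist (y i) p))
          ((((Finset.univ.filter fun k => dist (y k) (y i) ≤ 9 / 4).image y).filter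
            fun q => dist q (y i) < 1 / 4).card)
          ((((Finset.univ.filter fun k => dist (y k) (y i) ≤ 9 / 4).image y).filter
            fun q => dist q p < 1 / 4).card) := ⟨fun N y i => _, fun _ _ _ => rfl⟩
  refine ⟨F, fun N N' y y' i i' g _ _ hg h1 h2 => ?_, fun N y hy => ?_,
    fun N y i hy htame => ?_, fun N M y f i hy hf => ?_, fun N y i hy hcrowd => ?_⟩
  · rw [hF, hF, cloud_eq_image y y' i i' g hg h1 h2, ← hg]
    exact (cloud_sum_image (fun d a b => t (min 1 (max 0 (4 - 2 * d)) * lennardJones d) a b)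
      _ (y i) g).symm
  · rw [Finset.sum_congr rfl fun i _ => (hF N y i).trans (cloud_sum_eq_global t ht y hy i)]
    exact global_sum_eq_zero t ht y (fun r => min 1 (max 0 (4 - 2 * r)) * lennardJones r)
      fun k => (Finset.univ.filter fun j => dist (y j) (y k) < 1 / 4).card
  · rw [hF, cloud_sum_eq_global t ht y hy i]
    exact global_eq_zero_of_tame t ht y _ (fun _ => rfl) _ (fun _ => rfl) i htame
  · rw [hF, cloud_sum_eq_global t ht y hy (f i)]
    exact sub_le_global t ht y _ _ (fun _ => rfl) f i hf
  · rw [hF, cloud_sum_eq_global t ht y hy i]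
    exact one_le_global t ht y hy _ (fun _ => rfl) _ (fun _ => rfl) i hcrowd

/-- **`TruncatedCensusGap` from a sharp m-potential on uniformly `1/4`-separated configurations**
(the registered signature of `stub_sharpLocalisationSeparated`, line `sharp-m-potential-compactness`,
skeleton r3, as hypothesis): the crux follows through the landed separated reduction (p126512), the
redistribution at radius `9/4` (p124427), compactness extraction (p124882), the open margin (p125113,
tolerance `1/2000`), periodic stability (p84999) and `iInf_energyPerParticle_le_div` (p69766). -/
theorem truncatedCensusGap_of_sharpLocalisationSeparated :
    (∃ (R e₀ : ℝ) (H : (N : ℕ) → (Fin N → EuclideanSpace ℝ (Fin 3)) → Fin N → ℝ), 9 / 4 ≤ R ∧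
      (∀ (N : ℕ) (y : Fin N → EuclideanSpace ℝ (Fin 3)), Function.Injective y →
        (∀ j k : Fin N, j ≠ k → 1 / 4 ≤ dist (y j) (y k)) →
        ∑ i, H N y i ≤
          interactionEnergy (fun r => min 1 (max 0 (4 - 2 * r)) * lennardJones r) y - (N : ℝ) * e₀) ∧
      (∀ (N : ℕ) (y : Fin N → EuclideanSpace ℝ (Fin 3)) (i : Fin N), Function.Injective y →
        (∀ j k : Fin N, j ≠ k → 1 / 4 ≤ dist (y j) (y k)) → 0 ≤ H N y i) ∧
      (∀ (N N' : ℕ) (y : Fin N → EuclideanSpace ℝ (Fin 3)) (y' : Fin N' → EuclideanSpace ℝ (Fin 3))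
          (i : Fin N) (i' : Fin N')
          (g : EuclideanSpace ℝ (Fin 3) ≃ᵃⁱ[ℝ] EuclideanSpace ℝ (Fin 3)),
        Function.Injective y → Function.Injective y' →
        (∀ j k : Fin N, j ≠ k → 1 / 4 ≤ dist (y j) (y k)) →
        (∀ j k : Fin N', j ≠ k → 1 / 4 ≤ dist (y' j) (y' k)) →
        g (y i) = y' i' →
        (∀ j : Fin N, dist (y j) (y i) ≤ R - 1 / 4 → g (y j) ∈ Set.range y') →
        (∀ j' : Fin N', dist (y' j') (y' i') ≤ R - 1 / 4 → y' j' ∈ g '' Set.range y) →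
        H N y i = H N' y' i') ∧
      (∀ ε : ℝ, 0 < ε → ∃ θ : ℝ, 0 < θ ∧
        ∀ (N N' : ℕ) (y : Fin N → EuclideanSpace ℝ (Fin 3)) (y' : Fin N' → EuclideanSpace ℝ (Fin 3))
          (i : Fin N) (i' : Fin N')
          (g : EuclideanSpace ℝ (Fin 3) ≃ᵃⁱ[ℝ] EuclideanSpace ℝ (Fin 3)),
          Function.Injective y → Function.Injective y' →
          (∀ j k : Fin N, j ≠ k → 1 / 4 ≤ dist (y j) (y k)) →
          (∀ j k : Fin N', j ≠ k → 1 / 4 ≤ dist (y' j) (y' k)) →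
          g (y i) = y' i' →
          (∃ e : {j : Fin N // dist (y j) (y i) ≤ R} ≃ {j' : Fin N' // dist (y' j') (y' i') ≤ R},
            ∀ j, dist (g (y j.1)) (y' (e j).1) ≤ θ) →
          |H N y i - H N' y' i'| ≤ ε) ∧
      (∀ (N : ℕ) (y : Fin N → EuclideanSpace ℝ (Fin 3)) (i : Fin N), Function.Injective y →
        (∀ j k : Fin N, j ≠ k → 1 / 4 ≤ dist (y j) (y k)) →
        H N y i = 0 → ∀ δ : ℝ, 0 < δ →
          ∃ (a c : ℝ) (s : ℤ → ℤ) (g : EuclideanSpace ℝ (Fin 3) ≃ᵃⁱ[ℝ] EuclideanSpace ℝ (Fin 3)),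
            0 < a ∧ 9 / 2 * a ≤ R ∧ 812 / 1000 * a ≤ c ∧ c ≤ 821 / 1000 * a ∧ IsHaggSeq s ∧
            (∀ j k : Fin N, j ≠ k → dist (y j) (y i) ≤ 4 * a → a / 2 ≤ dist (y j) (y k)) ∧
            BallMatch (δ * a) (4 * a) (y i) (Set.range y) (g '' barlowStacking a c s)) ∧
      (∀ ε : ℝ, 0 < ε → ∃ (N : ℕ) (y : Fin N → EuclideanSpace ℝ (Fin 3)), 0 < N ∧
        Function.Injective y ∧
        interactionEnergy (fun r => min 1 (max 0 (4 - 2 * r)) * lennardJones r) y ≤ (N : ℝ) * (e₀ + ε))) →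
    Summit.AtomisticToContinuum.Crystallization.Theses.PricedLinkCensus.TruncatedCensusGap := by
  intro hSLS
  obtain ⟨R, r₀, e₀, M₀, H, hr₀, hM₀, hsum, hnn, hloc, hcont, hzero, hrich, hclu⟩ :=
    stub_separatedReduction hSLS superstableRedistribution94'
  obtain ⟨δ₁, hδ₁, hmargin⟩ := stub_chargeFreeOpenAtBarlow
  obtain ⟨κ, hκ, hfloor⟩ := stub_compactnessExtraction R r₀ H hr₀ hloc hcont hnn hzero δ₁ hδ₁
  have h₅ := stub_periodicStability
  -- (1) `e_χ* ≤ e₀`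
  have heStar : (⨅ Q : PeriodicConfiguration 3,
      Q.energyPerParticle fun r => min 1 (max 0 (4 - 2 * r)) * lennardJones r) ≤ e₀ := by
    refine le_of_forall_pos_le_add fun ε hε => ?_
    obtain ⟨N, y, hN, hy, hE⟩ := hclu ε hε
    have h1 : (⨅ Q : PeriodicConfiguration 3,
        Q.energyPerParticle fun r => min 1 (max 0 (4 - 2 * r)) * lennardJones r) ≤
        interactionEnergy (fun r => min 1 (max 0 (4 - 2 * r)) * lennardJones r) y / N :=
      Summit.AtomisticToContinuum.Crystallization.Theorems.iInf_energyPerParticle_le_div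
        (V := fun r => min 1 (max 0 (4 - 2 * r)) * lennardJones r) (R := 2)
        (fun r hr => truncLJ_eq_zero hr) h₅ hy hN
    have hN' : (0 : ℝ) < N := by exact_mod_cast hN
    rw [le_div_iff₀ hN'] at h1
    have h2 : (⨅ Q : PeriodicConfiguration 3,
        Q.energyPerParticle fun r => min 1 (max 0 (4 - 2 * r)) * lennardJones r) * N ≤
        (e₀ + ε) * N := by linarith
    exact le_of_mul_le_mul_right h2 hN'
  -- constants
  set R' : ℝ := max R 0 with hR'
  have hR'0 : 0 ≤ R' := le_max_right _ _
  set K : ℝ := (2 * R' / r₀ + 1) ^ Module.finrank ℝ (EuclideanSpace ℝ (Fin 3)) with hK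
  have hK0 : 0 ≤ K := by positivity
  have hK1 : 0 < K + 1 := by linarith
  have hκ' : 0 < min κ (M₀ / (K + 1)) := lt_min hκ (div_pos hM₀ hK1)
  refine ⟨min κ (M₀ / (K + 1)), hκ', fun N y hy => ?_⟩
  set κ' : ℝ := min κ (M₀ / (K + 1)) with hκ'def
  have hκ'le1 : κ' ≤ κ := min_le_left _ _
  have hκ'le2 : κ' * (K + 1) ≤ M₀ := by
    have := min_le_right κ (M₀ / (K + 1))
    rwa [le_div_iff₀ hK1] at this
  -- the finsets of the counting (crowd-free at scale `r₀`, tame `R`-patch at scale `r₀`)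
  set Ch := Finset.univ.filter fun i : Fin N => ¬ IsChargeFree (1 / 100 : ℝ) y i with hCh
  set Crowd := Finset.univ.filter fun i : Fin N =>
    ¬ ∀ k : Fin N, k ≠ i → r₀ ≤ dist (y k) (y i) with hCrowd
  set TameCh := Ch.filter fun i => (∀ k : Fin N, k ≠ i → r₀ ≤ dist (y k) (y i)) ∧
    (∀ j k : Fin N, j ≠ k → dist (y j) (y i) ≤ R → dist (y k) (y i) ≤ R → r₀ ≤ dist (y j) (y k))
    with hTameCh
  set Poor := Ch.filter fun i => (∀ k : Fin N, k ≠ i → r₀ ≤ dist (y k) (y i)) ∧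
    ¬ (∀ j k : Fin N, j ≠ k → dist (y j) (y i) ≤ R → dist (y k) (y i) ≤ R → r₀ ≤ dist (y j) (y k))
    with hPoor
  have hcardNat : (Nat.card {i : Fin N // ¬ IsChargeFree (1 / 100 : ℝ) y i} : ℝ) = Ch.card := by
    rw [Nat.card_eq_fintype_card, Fintype.card_subtype]
  -- (2) every charged site is tame & crowd-free, or poor (crowd-free, non-tame), or crowded
  have hcover : Ch ⊆ TameCh ∪ Poor ∪ Crowd := by
    intro i hi
    by_cases hiso : ∀ k : Fin N, k ≠ i → r₀ ≤ dist (y k) (y i)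
    · by_cases ht : ∀ j k : Fin N, j ≠ k → dist (y j) (y i) ≤ R → dist (y k) (y i) ≤ R →
          r₀ ≤ dist (y j) (y k)
      · exact Finset.mem_union_left _
          (Finset.mem_union_left _ (Finset.mem_filter.2 ⟨hi, hiso, ht⟩))
      · exact Finset.mem_union_left _
          (Finset.mem_union_right _ (Finset.mem_filter.2 ⟨hi, hiso, ht⟩))
    · exact Finset.mem_union_right _ (Finset.mem_filter.2 ⟨Finset.mem_univ _, hiso⟩)
  have hcardCh : (Ch.card : ℝ) ≤ TameCh.card + Poor.card + Crowd.card := by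
    have h1 := Finset.card_le_card hcover
    have h2 := Finset.card_union_le (TameCh ∪ Poor) Crowd
    have h3 := Finset.card_union_le TameCh Poor
    exact_mod_cast h1.trans (h2.trans (Nat.add_le_add_right h3 _))
  -- (3) poor sites are few: `#Poor ≤ K · #Crowd`
  have hPoor : (Poor.card : ℝ) ≤ K * Crowd.card := by
    refine card_le_mul_card_crowded' hy hr₀ hR'0 Poor fun i hi => ?_
    obtain ⟨-, hiso, hnt⟩ := Finset.mem_filter.1 hi
    obtain ⟨j, hj, hd⟩ := exists_crowded_near_of_not_tame hnt
    exact ⟨hiso, j, hj, hd.trans (le_max_left _ _)⟩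
  -- (4) floors: compactness + open margin on tame charged sites, `M₀` on crowded sites
  have hTame : ∀ i ∈ TameCh, κ ≤ H N y i := by
    intro i hi
    obtain ⟨hiCh, -, ht⟩ := Finset.mem_filter.1 hi
    by_contra hlt
    push Not at hlt
    exact (Finset.mem_filter.1 hiCh).2 (hmargin N y i (hfloor N y i hy ht hlt))
  have hCrowdfl : ∀ j ∈ Crowd, M₀ ≤ H N y j := fun j hj =>
    hrich N y j hy (Finset.mem_filter.1 hj).2
  -- (5) the sum of `H` dominates both floors
  have hdisj : Disjoint TameCh Crowd := by
    rw [Finset.disjoint_left]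
    intro i hi hi'
    exact (Finset.mem_filter.1 hi').2 (Finset.mem_filter.1 hi).2.1
  have hsumge : κ * TameCh.card + M₀ * Crowd.card ≤ ∑ i, H N y i := by
    have h1 : ∑ i ∈ TameCh ∪ Crowd, H N y i ≤ ∑ i, H N y i :=
      Finset.sum_le_univ_sum_of_nonneg fun i => hnn N y i hy
    rw [Finset.sum_union hdisj] at h1
    have h2 : κ * TameCh.card ≤ ∑ i ∈ TameCh, H N y i := by
      have := Finset.card_nsmul_le_sum TameCh (fun i => H N y i) κ fun i hi => hTame i hi
      simpa [nsmul_eq_mul, mul_comm] using this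
    have h3 : M₀ * Crowd.card ≤ ∑ i ∈ Crowd, H N y i := by
      have := Finset.card_nsmul_le_sum Crowd (fun i => H N y i) M₀ fun i hi => hCrowdfl i hi
      simpa [nsmul_eq_mul, mul_comm] using this
    linarith
  -- (6) assemble
  have hmain : κ' * Ch.card ≤ ∑ i, H N y i := by
    have hT0 : (0 : ℝ) ≤ TameCh.card := Nat.cast_nonneg _
    have hC0 : (0 : ℝ) ≤ Crowd.card := Nat.cast_nonneg _
    have hκ'0 : 0 ≤ κ' := hκ'.le
    calc κ' * Ch.card ≤ κ' * (TameCh.card + Poor.card + Crowd.card) := by gcongr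
      _ ≤ κ' * TameCh.card + κ' * (K + 1) * Crowd.card := by nlinarith
      _ ≤ κ * TameCh.card + M₀ * Crowd.card := by
          have ha : κ' * TameCh.card ≤ κ * TameCh.card := mul_le_mul_of_nonneg_right hκ'le1 hT0
          have hb : κ' * (K + 1) * Crowd.card ≤ M₀ * Crowd.card :=
            mul_le_mul_of_nonneg_right hκ'le2 hC0
          linarith
      _ ≤ ∑ i, H N y i := hsumge
  have hdom := hsum N y hy
  rw [hcardNat]
  have hN0 : (0 : ℝ) ≤ N := Nat.cast_nonneg N
  have hNe : (N : ℝ) * (⨅ Q : PeriodicConfiguration 3,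
      Q.energyPerParticle fun r => min 1 (max 0 (4 - 2 * r)) * lennardJones r) ≤ (N : ℝ) * e₀ :=
    mul_le_mul_of_nonneg_left heStar hN0
  linarith

end Summit.AtomisticToContinuum.Crystallization.Theorems.PricedLinkCensusTruncatedCensusGap

end
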